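import Literature.NumberTheory.DiophantineGeometry.WeilPairingRationalTateModulePinned
import Literature.AlgebraicGeometry.Motives.AbelianVarietyWeilPairingGaloisConjugate
import Literature.AlgebraicGeometry.Motives.AbelianVarietyWeilPairingDivisorClass
import HarnessLib

/-!
# The pinned `ℓ`-adic Weil pairing for a divisor that is Galois invariant only at the level of PAIRINGS

Sibling (theorems only; no definition, no named fact, no instance, no `sorry`) of ★ `WeilPairingRationalTateModulePinned`, whose head
`exists_bilinForm_rationalTateModule_of_isAmple` asks the ample divisor `Θ` on `B_{K̄}` to be Galois invariant AS A DIVISOR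
(`(gal τ)^* Θ ∼ Θ`, `SameDivisor`).  A Riemann theta divisor of a Jacobian is invariant only up to translation; what survives is the
invariance of its LEVEL WEIL PAIRINGS, `ē_N^{(gal τ)^* Θ} = ē_N^Θ` (translates give the same `ē`).  Using ★
`AbelianVarietyWeilPairingGaloisConjugate.weilPairingLevel_galSmul_pullback` (`ē_N^Θ(σ r, σ s) = σ ē_N^{(gal σ)^*Θ}(r, s)` for every `Θ`),
the whole assembly of ★ `WeilPairingRationalTateModulePinned` runs under that weaker hypothesis:

* `levelFun_smul_eq_of_pairing_invariant` — Galois equivariance of the level pairing function (★ `levelFun_smul_eq` with the divisor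
  invariance replaced by pairing invariance);
* `exists_levelWeilPairing_eq_weilPairingLevel_of_pairing_invariant`;
* **`exists_bilinForm_rationalTateModule_of_isAmple_of_weilPairingLevel_galInvariant`** — `∃ W e, (W.e k = ē_{pᵏ}^Θ) ∧ (e ∘ toRational =
  c ∘ W.tatePairing) ∧ e.IsAlt ∧ e.Nondegenerate ∧ e (g x, g y) = χ_p(g) e (x, y)` for `Θ` ample with `Gal(K̄/K)`-invariant PAIRINGS.

Cell `hodgecm-mathlib` (D-0151), road (P) of the d6 S2′ socket `SocketRos`, A-plan2 (g12) 2026-08-30T03:11:15Z / 03:14:37Z reshape («no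
`E`-rational divisor in the theta class is ever assumed»); count-neutral.  HC_CM is proved only modulo the 7 printed citations until rung 0 closes.

## References
* [Milne1986AbelianVarieties] J. S. Milne, *Abelian varieties*, in Cornell–Silverman (eds.), *Arithmetic Geometry* (1986), §16 (pp. 131–132), Lemma 16.1–16.2.
* [Lang1983AbelianVarieties] S. Lang, *Abelian Varieties*, Ch. VII §2, Props. 2–7 and Thm. 5.
* [MumfordAV1970] D. Mumford, *Abelian Varieties* (1970), §20.
-/

set_option autoImplicit false

noncomputable section

open scoped Classical
open scoped AddSubgroup TensorProduct

open AlgebraicGeometry CategoryTheory Function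

namespace Literature.NumberTheory.DiophantineGeometry

open Literature.NumberTheory.EllipticCurves Literature.NumberTheory.GaloisRepresentations
open Literature.AlgebraicGeometry.Motives Literature.AlgebraicGeometry.Motives.AbelianVariety RatFn

universe u

section Geometric

variable {K : Type u} [Field K] (B : AbelianVariety K) (p : ℕ) [Fact p.Prime]

section Axioms

variable [hdom : ∀ k : ℕ,
  IsDominant (Hom.toSchemeHom (((p ^ k : ℕ) : ℤ) • 𝟙 (B.baseChange (AlgebraicClosure K))))]
variable (Θ : CartierDivisor (B.baseChange (AlgebraicClosure K)).X.left)
variable (e : ℕ → B.geomPoints → B.geomPoints → AlgebraicClosure K)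
variable (he : ∀ (k : ℕ) (x y : B.geomPoints)
  (hx : (Additive.toMul x : B.Points (AlgebraicClosure K)) ^ p ^ k = 1)
  (hy : (Additive.toMul y : B.Points (AlgebraicClosure K)) ^ p ^ k = 1),
  e k x y = (B.baseChange (AlgebraicClosure K)).weilPairingLevel (N := p ^ k) Θ
    (B.torsionPt (AlgebraicClosure K) hx) (B.torsionPt (AlgebraicClosure K) hy))

include he in
omit [Fact p.Prime] in
/-- **Galois equivariance of the level pairing function from PAIRING-level invariance of `Θ`** (★ `levelFun_smul_eq` with
`(gal τ)^* Θ ∼ Θ` replaced by `ē^{(gal τ)^* Θ} = ē^Θ`, through ★ `weilPairingLevel_galSmul_of_pairing_invariant`).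
[cite: Milne1986AbelianVarieties, §16 (p. 131, the pairings ē_m)] -/
theorem levelFun_smul_eq_of_pairing_invariant
    (hΘ : ∀ (τ : AlgebraicClosure K ≃ₐ[K] AlgebraicClosure K) (N : ℕ)
      [IsDominant (Hom.toSchemeHom ((N : ℤ) • 𝟙 (B.baseChange (AlgebraicClosure K))))]
      (R S : (B.baseChange (AlgebraicClosure K)).torsionPoints (AlgebraicClosure K) N),
      (B.baseChange (AlgebraicClosure K)).weilPairingLevel (Θ.pullback (B.galX (AlgebraicClosure K) τ)) R S =
        (B.baseChange (AlgebraicClosure K)).weilPairingLevel Θ R S)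
    (k : ℕ) (σ : Field.absoluteGaloisGroup K) (x y : B.geomPoints)
    (hx : x ∈ (B.geomPoints)[(p ^ k : ℕ)]) (hy : y ∈ (B.geomPoints)[(p ^ k : ℕ)]) :
    σ • e k x y = e k (σ • x) (σ • y) := by
  have hx' := toMul_pow_eq_one_of_mem_torsionBy B hx
  have hy' := toMul_pow_eq_one_of_mem_torsionBy B hy
  have hσx : (Additive.toMul (σ • x) : B.Points (AlgebraicClosure K)) ^ p ^ k = 1 :=
    B.smul_pow_eq_one (AlgebraicClosure K) (Field.absoluteGaloisGroup.toAlgEquiv K σ) hx'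
  have hσy : (Additive.toMul (σ • y) : B.Points (AlgebraicClosure K)) ^ p ^ k = 1 :=
    B.smul_pow_eq_one (AlgebraicClosure K) (Field.absoluteGaloisGroup.toAlgEquiv K σ) hy'
  rw [he k x y hx' hy', he k (σ • x) (σ • y) hσx hσy, Field.absoluteGaloisGroup.smul_def]
  exact (B.weilPairingLevel_galSmul_of_pairing_invariant (AlgebraicClosure K) Θ
    (Field.absoluteGaloisGroup.toAlgEquiv K σ) (hΘ (Field.absoluteGaloisGroup.toAlgEquiv K σ) (p ^ k)) hx' hy').symm

end Axioms

/-- **A `LevelWeilPairing` whose pairings ARE `ē_{pᵏ}^Θ`, for `Θ` ample with Galois-invariant PAIRINGS.**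
[cite: Milne1986AbelianVarieties, §16 (p. 131, the pairings ē_m) and Lemma 16.1] [cite: Lang1983AbelianVarieties, Ch. VII §2 Props. 3–5] -/
theorem exists_levelWeilPairing_eq_weilPairingLevel_of_pairing_invariant (hp : (p : K) ≠ 0)
    (Θ : CartierDivisor (B.baseChange (AlgebraicClosure K)).X.left) (hΘ : Θ.IsAmple)
    (hΘinv : ∀ (τ : AlgebraicClosure K ≃ₐ[K] AlgebraicClosure K) (N : ℕ)
      [IsDominant (Hom.toSchemeHom ((N : ℤ) • 𝟙 (B.baseChange (AlgebraicClosure K))))]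
      (R S : (B.baseChange (AlgebraicClosure K)).torsionPoints (AlgebraicClosure K) N),
      (B.baseChange (AlgebraicClosure K)).weilPairingLevel (Θ.pullback (B.galX (AlgebraicClosure K) τ)) R S =
        (B.baseChange (AlgebraicClosure K)).weilPairingLevel Θ R S) :
    ∃ W : LevelWeilPairing K B.geomPoints p,
      ∀ (k : ℕ) (x y : B.geomPoints) (hx : (Additive.toMul x : B.Points (AlgebraicClosure K)) ^ p ^ k = 1)
        (hy : (Additive.toMul y : B.Points (AlgebraicClosure K)) ^ p ^ k = 1),
        haveI : IsDominant (Hom.toSchemeHom (((p ^ k : ℕ) : ℤ) • 𝟙 (B.baseChange (AlgebraicClosure K)))) :=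
          isDominant_natCast_zsmul_baseChange B (p ^ k) (pow_ne_zero k (Fact.out : p.Prime).ne_zero)
        W.e k x y = (B.baseChange (AlgebraicClosure K)).weilPairingLevel (N := p ^ k) Θ
          (B.torsionPt (AlgebraicClosure K) hx) (B.torsionPt (AlgebraicClosure K) hy) := by
  have hpr : p.Prime := Fact.out
  haveI hdom : ∀ k : ℕ,
      IsDominant (Hom.toSchemeHom (((p ^ k : ℕ) : ℤ) • 𝟙 (B.baseChange (AlgebraicClosure K)))) :=
    fun k => isDominant_natCast_zsmul_baseChange B (p ^ k) (pow_ne_zero k hpr.ne_zero)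
  obtain ⟨e, he⟩ := exists_levelFun B p Θ
  obtain ⟨c, hc⟩ := levelFun_exists_radical_le B p _ e he hp hΘ
  exact ⟨{ e := e
           pow_eq_one := levelFun_pow_eq_one B p _ e he
           add_left := levelFun_add_left B p _ e he
           add_right := levelFun_add_right B p _ e he
           self_eq_one := levelFun_self_eq_one B p _ e he
           smul_eq := levelFun_smul_eq_of_pairing_invariant B p _ e he (fun τ N _ R S => hΘinv τ N R S)
           pow_succ_eq := levelFun_pow_succ_eq B p _ e he
           exists_radical_le := ⟨c, hc⟩ }, fun k x y hx hy => he k x y hx hy⟩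

/-- **The `ℓ`-adic Weil pairing of `Θ` on `V_p B`, pinned to `ē_{pᵏ}^Θ`, for `Θ` ample with Galois-invariant PAIRINGS** (no `E`-rational
divisor in the class of `Θ` is assumed): the five conjuncts of ★ `exists_bilinForm_rationalTateModule_of_isAmple` verbatim.
[cite: Milne1986AbelianVarieties, §16 Lemma 16.1–16.2 (pp. 131–132)] [cite: Lang1983AbelianVarieties, Ch. VII §2 Thm. 5] -/
theorem exists_bilinForm_rationalTateModule_of_isAmple_of_weilPairingLevel_galInvariant (hp : (p : K) ≠ 0)
    (c : TateModule (Additive (AlgebraicClosure K)ˣ) p →ₗ[ℤ_[p]] ℤ_[p]) (hc : Injective c)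
    (Θ : CartierDivisor (B.baseChange (AlgebraicClosure K)).X.left) (hΘ : Θ.IsAmple)
    (hΘinv : ∀ (τ : AlgebraicClosure K ≃ₐ[K] AlgebraicClosure K) (N : ℕ)
      [IsDominant (Hom.toSchemeHom ((N : ℤ) • 𝟙 (B.baseChange (AlgebraicClosure K))))]
      (R S : (B.baseChange (AlgebraicClosure K)).torsionPoints (AlgebraicClosure K) N),
      (B.baseChange (AlgebraicClosure K)).weilPairingLevel (Θ.pullback (B.galX (AlgebraicClosure K) τ)) R S =
        (B.baseChange (AlgebraicClosure K)).weilPairingLevel Θ R S) :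
    ∃ (W : LevelWeilPairing K B.geomPoints p) (e : LinearMap.BilinForm ℚ_[p] (B.rationalTateModule p)),
      (∀ (k : ℕ) (x y : B.geomPoints) (hx : (Additive.toMul x : B.Points (AlgebraicClosure K)) ^ p ^ k = 1)
          (hy : (Additive.toMul y : B.Points (AlgebraicClosure K)) ^ p ^ k = 1),
          haveI : IsDominant (Hom.toSchemeHom (((p ^ k : ℕ) : ℤ) • 𝟙 (B.baseChange (AlgebraicClosure K)))) :=
            isDominant_natCast_zsmul_baseChange B (p ^ k) (pow_ne_zero k (Fact.out : p.Prime).ne_zero)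
          W.e k x y = (B.baseChange (AlgebraicClosure K)).weilPairingLevel (N := p ^ k) Θ
            (B.torsionPt (AlgebraicClosure K) hx) (B.torsionPt (AlgebraicClosure K) hy)) ∧
      (∀ t t' : TateModule B.geomPoints p,
          e (TateModule.toRational p t) (TateModule.toRational p t') = ((c (W.tatePairing t t') : ℤ_[p]) : ℚ_[p])) ∧
      e.IsAlt ∧ e.Nondegenerate ∧
      ∀ (g : Field.absoluteGaloisGroup K) (x y : B.rationalTateModule p),
        e (B.rationalTateRep p g x) (B.rationalTateRep p g y) =
          (((GaloisRep.cyclotomicCharacter K p g : ℤ_[p]ˣ) : ℤ_[p]) : ℚ_[p]) * e x y := by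
  haveI : NeZero (p : K) := ⟨hp⟩
  obtain ⟨W, hW⟩ := exists_levelWeilPairing_eq_weilPairingLevel_of_pairing_invariant B p hp Θ hΘ hΘinv
  have hproj : ∀ k, ∀ y ∈ (B.geomPoints)[(p ^ k : ℕ)],
      ∃ t : TateModule B.geomPoints p, TateModule.proj p k t = y := fun k y hy =>
    TateModule.exists_proj_eq_of_smul_surjective
      (B.nsmul_geomPoints_surjective_of_ne_zero p (Fact.out : p.Prime).ne_zero) k hy
  set E : LinearMap.BilinForm ℤ_[p] (TateModule B.geomPoints p) := W.tatePairing.compr₂ c with hE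
  have h1 : ∀ t, E t t = 0 := fun t => by
    rw [hE, LinearMap.compr₂_apply, LevelWeilPairing.tatePairing_self, map_zero]
  have h2 : ∀ t, (∀ t', E t t' = 0) → t = 0 := fun t ht => by
    refine W.eq_zero_of_forall_tatePairing_eq_zero hproj fun t' => hc ?_
    rw [map_zero]
    have := ht t'
    rwa [hE, LinearMap.compr₂_apply] at this
  have h3 : ∀ (σ : Field.absoluteGaloisGroup K) (t t' : TateModule B.geomPoints p),
      E (σ • t) (σ • t') = ((GaloisRep.cyclotomicCharacter K p σ : ℤ_[p]ˣ) : ℤ_[p]) * E t t' := fun σ t t' => by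
    rw [hE, LinearMap.compr₂_apply, LinearMap.compr₂_apply, LevelWeilPairing.tatePairing_smul, map_smul, smul_eq_mul]
  obtain ⟨e, hpin, hAlt, hNd, hGal⟩ := exists_bilinForm_rationalTateModule_pinned p E h1 h2 h3
  refine ⟨W, e, hW, fun t t' => ?_, hAlt, hNd, hGal⟩
  rw [hpin t t', hE, LinearMap.compr₂_apply]

/-- **Divisor-level invariance implies pairing-level invariance** (★ `weilPairingLevel_congr_sameDivisor`): the head of ★
`exists_bilinForm_rationalTateModule_of_isAmple` is the special case `(gal τ)^* Θ ∼ Θ`. [cite: Milne1986AbelianVarieties, §16 (p. 131, the pairings ē_m)] -/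
theorem weilPairingLevel_pullback_galX_eq_of_sameDivisor (Θ : CartierDivisor (B.baseChange (AlgebraicClosure K)).X.left)
    (hΘinv : ∀ τ : AlgebraicClosure K ≃ₐ[K] AlgebraicClosure K,
      (Θ.pullback (B.galX (AlgebraicClosure K) τ)).SameDivisor Θ)
    (τ : AlgebraicClosure K ≃ₐ[K] AlgebraicClosure K) (N : ℕ)
    [IsDominant (Hom.toSchemeHom ((N : ℤ) • 𝟙 (B.baseChange (AlgebraicClosure K))))]
    (R S : (B.baseChange (AlgebraicClosure K)).torsionPoints (AlgebraicClosure K) N) :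
    (B.baseChange (AlgebraicClosure K)).weilPairingLevel (Θ.pullback (B.galX (AlgebraicClosure K) τ)) R S =
      (B.baseChange (AlgebraicClosure K)).weilPairingLevel Θ R S :=
  weilPairingLevel_congr_sameDivisor (hΘinv τ) R S

end Geometric

end Literature.NumberTheory.DiophantineGeometry

end
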